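import Summits.CriticalPhenomena.PercolationContinuityZ3.Theorems.Transplant.PlanarSkeletonFrmFromDefs
import Summits.CriticalPhenomena.PercolationContinuityZ3.Theorems.Transplant.SkelFrmFromBParamsBridge0
import Summits.CriticalPhenomena.PercolationContinuityZ3.Theorems.Transplant.SkelFrmBParamsBridge0
import Summits.CriticalPhenomena.PercolationContinuityZ3.Theorems.Transplant.SkelPhiRootCrossLink
import Summits.CriticalPhenomena.PercolationContinuityZ3.Theorems.Transplant.SkelPhiCorridorKGValues
import HarnessLib
import Summits.CriticalPhenomena.PercolationContinuityZ3.Theorems.Transplant.SkelFrmBChoiceRootLanding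
/-!
# U-WAVE PORT (RULING D-U, lead g21 2026-08-26; WAVE-U-MANIFEST v3.0 row «SkelFrmBChoiceRootLanding» ↦ «SkelFrmFromBChoiceRootLanding») of the tree module
# `Transplant/SkelFrmBChoiceRootLanding` onto the carrier `PlanarSkeletonFrmFrom` (frames only, cylinders connected from width `ℓ₀` on)

ORIGINAL TITLE: N2 (frames-only node `SamePDropOfSkeletonFrm₁`, OPEN), (R) value layer — part RootLanding: **THE LANDING VERTEX `c₁` OF THE ROOT'S K-G CORRIDOR**

builds on p205010 (kernel theorem, internal audit signed; external expert review pending) — nothing in this file uses p205010; NOTHING is claimed about the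
OPEN node U `SamePDropOfSkeletonFrmFrom₁` (nor U_s / the end state).  Lane `prim-bschramm`, seat `prim-hp-8 gen 53 (U-wave port pen, family P-hp8; tool of record = p3-g26 port_u.py)`; helper file
(`--supports stmt-CriticalPhenomena-4575 --as helper`).  PORT RULES r1–r4 of RULING D-U: declaration order and proof texts are those of the original,
byte-identical except (i) the carrier token `PlanarSkeletonFrm ↦ PlanarSkeletonFrmFrom` (binders, `namespace`/`end` lines, qualified names of twinned
declarations), (ii) carrier-FREE declarations of the original (φ-level `Skelφ…` blocks and namespace-only arithmetic residents) are NOT re-declared —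
this file imports the original and `export`s the twin-free residents (POLICY T / treatment (m1)); residents whose statement mentions a twinned
constant are copied, (iii) every carrier-binding declaration keeps its explicit binder `(Φ : PlanarSkeletonFrmFrom G)` in its own signature (r2).  Docstrings and citations are the original's.  Manifest row idx 120 (level 15; flags verbatim|DEF-ROW|RESIDENTS(T:0/free:1)); filed by the hp-8 lineage under RULING M-11 (family P-hp8).
-/

noncomputable section

open scoped Classical

namespace Summit.CriticalPhenomena.PercolationContinuityZ3.Theorems.Transplant

open Literature.Probability.Percolation Literature.Probability.LatticeModels SimpleGraph
open Literature.Barriers.CriticalPhenomena (graphBall)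

namespace PlanarSkeletonFrmFrom

namespace NegB

open SkelConc (Consts)
open Skelφ (rootFrame shearUnit)
open ChainPlanar (BridgePrm BridgeOK)
open Neg

namespace KS

/-! ## §1 The landing point -/

section Landing

variable (κ : Consts) {V : Type} [DecidableEq V] [Countable V] {G : SimpleGraph V} [G.LocallyFinite] (Φ : PlanarSkeletonFrmFrom G) (t : V) (p : unitInterval)
  (D : Skelφ.StepI.DataNS V) (mk g f qq : ℕ)

/-- **The landing x-offset** `X1 := core1Lo 0 + q` (the bridge landing sits at the BACK END of the corridor's core `0`). [this work] -/
def X1 (κ : Consts) {V : Type} [DecidableEq V] [Countable V] {G : SimpleGraph V} [G.LocallyFinite] (Φ : PlanarSkeletonFrmFrom G) (t : V) (p : unitInterval) (D : Skelφ.StepI.DataNS V) (mk : ℕ) (g : ℕ) (f : ℕ) (qq : ℕ) : ℤ := (B0 κ Φ t p D mk g f).core1Lo 0 + qq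

/-- **The landing y-offset** `Y1 := core1Lo 1 + ⌊h_L·q/n_L⌋` (follows the corridor's shear line back from core `0`'s centre). [this work] -/
def Y1 (κ : Consts) {V : Type} [DecidableEq V] [Countable V] {G : SimpleGraph V} [G.LocallyFinite] (Φ : PlanarSkeletonFrmFrom G) (t : V) (p : unitInterval) (D : Skelφ.StepI.DataNS V) (mk : ℕ) (g : ℕ) (f : ℕ) (qq : ℕ) : ℤ := (B0 κ Φ t p D mk g f).core1Lo 1 + hL κ Φ t p D g f * (qq : ℤ) / (nL κ Φ t p D g f : ℤ)

/-- **The landing depth** `D0 := |X1| + |Y1|` (the skeleton's `D₀`: `c₁ ∈ B(t, D0)`). [this work] -/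
def D0 (κ : Consts) {V : Type} [DecidableEq V] [Countable V] {G : SimpleGraph V} [G.LocallyFinite] (Φ : PlanarSkeletonFrmFrom G) (t : V) (p : unitInterval) (D : Skelφ.StepI.DataNS V) (mk : ℕ) (g : ℕ) (f : ℕ) (qq : ℕ) : ℕ := (X1 κ Φ t p D mk g f qq).natAbs + (Y1 κ Φ t p D mk g f qq).natAbs

/-- `X1 = n_L − R'0 + nB0 + q`. [folklore] -/
theorem X1_eq (κ : Consts) {V : Type} [DecidableEq V] [Countable V] {G : SimpleGraph V} [G.LocallyFinite] (Φ : PlanarSkeletonFrmFrom G) (t : V) (p : unitInterval) (D : Skelφ.StepI.DataNS V) (mk : ℕ) (g : ℕ) (f : ℕ) (qq : ℕ) : X1 κ Φ t p D mk g f qq = (nL κ Φ t p D g f : ℤ) - KS0.R'0 κ Φ t p D mk + nB0 κ Φ t p D mk + qq := by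
  unfold X1; rw [(B0_core1 κ Φ t p D mk g f).1]

/-- `Y1 = h_L − R'0 + hB0 + ⌊h_L q/n_L⌋`. [folklore] -/
theorem Y1_eq (κ : Consts) {V : Type} [DecidableEq V] [Countable V] {G : SimpleGraph V} [G.LocallyFinite] (Φ : PlanarSkeletonFrmFrom G) (t : V) (p : unitInterval) (D : Skelφ.StepI.DataNS V) (mk : ℕ) (g : ℕ) (f : ℕ) (qq : ℕ) : Y1 κ Φ t p D mk g f qq = hL κ Φ t p D g f - KS0.R'0 κ Φ t p D mk + hB0 κ Φ t p D mk + hL κ Φ t p D g f * (qq : ℤ) / (nL κ Φ t p D g f : ℤ) := by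
  unfold Y1; rw [(B0_core1 κ Φ t p D mk g f).2.1]

/-- **`hX₁`** (the skeleton's (R-F2′) row): `Rs + q + R'0 + n_L < X1`. [folklore] -/
theorem hX₁_0 (κ : Consts) {V : Type} [DecidableEq V] [Countable V] {G : SimpleGraph V} [G.LocallyFinite] (Φ : PlanarSkeletonFrmFrom G) (t : V) (p : unitInterval) (D : Skelφ.StepI.DataNS V) (mk : ℕ) (g : ℕ) (f : ℕ) (qq : ℕ) : ((KS.Rs t D mk : ℕ) : ℤ) + qq + KS0.R'0 κ Φ t p D mk + nL κ Φ t p D g f < X1 κ Φ t p D mk g f qq := by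
  have h := core1Lo_0_ge κ Φ t p D mk g f
  unfold X1
  linarith

/-- **THE LANDING VERTEX EXISTS** (any planar map with unit steps): `c₁ ∈ B_G(t, D0)` with `ψ c₁ − ψ t = (X1, Y1)`. [folklore] -/
theorem exists_landing0 (κ : Consts) {V : Type} [DecidableEq V] [Countable V] {G : SimpleGraph V} [G.LocallyFinite] (Φ : PlanarSkeletonFrmFrom G) (t : V) (p : unitInterval) (D : Skelφ.StepI.DataNS V) (mk : ℕ) (g : ℕ) (f : ℕ) (qq : ℕ) {ψ : V → Site 2} (hstep : Skelφ.Steps G ψ) :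
    ∃ c₁, c₁ ∈ graphBall G t (D0 κ Φ t p D mk g f qq) ∧ ψ c₁ 0 - ψ t 0 = X1 κ Φ t p D mk g f qq ∧ ψ c₁ 1 - ψ t 1 = Y1 κ Φ t p D mk g f qq := by
  obtain ⟨c₁, hc, hy⟩ := Skelφ.exists_mem_graphBall_φ_eq hstep t (ψ t + Skelφ.pt (X1 κ Φ t p D mk g f qq) (Y1 κ Φ t p D mk g f qq))
  have e0 : (ψ t + Skelφ.pt (X1 κ Φ t p D mk g f qq) (Y1 κ Φ t p D mk g f qq)) 0 - ψ t 0 = X1 κ Φ t p D mk g f qq := by simp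
  have e1 : (ψ t + Skelφ.pt (X1 κ Φ t p D mk g f qq) (Y1 κ Φ t p D mk g f qq)) 1 - ψ t 1 = Y1 κ Φ t p D mk g f qq := by simp
  rw [e0, e1] at hc
  refine ⟨c₁, hc, ?_, ?_⟩
  · have := congrFun hy 0; simp only [Pi.add_apply, Skelφ.pt_zero] at this; linarith
  · have := congrFun hy 1; simp only [Pi.add_apply, Skelφ.pt_one] at this; linarith

/-! ## §2 The six numeric rows of the cross link -/

export PlanarSkeletonFrm.NegB.KS (budget_mul_shearUnit_ge)

/-- **THE SIX ROWS OF THE CROSS LINK** at `(lo, hi) := (core1Lo, core1Hi)` of the root bridge, `X1`, `Y1`: `hx0`, `hx1` (along: exact, `R'0 ≤ q`) and `hs₁…hs₄`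
(across: the shear placement leaves `E = h_L q mod n_L ∈ [0, n_L)`; the box height `ℓ_L + 2R'0 + ℓB0` and the corner terms `2|h_L|R'0` are absorbed by `P·U ≥ n_Lℓ_L + 1`
and `W ≥ ℓB0 + 2R'0 + 1`). [cite: KozmaNitzan2024, §4 Lemma 11 (p. 22)] -/
theorem hx_rows_0 (κ : Consts) {V : Type} [DecidableEq V] [Countable V] {G : SimpleGraph V} [G.LocallyFinite] (Φ : PlanarSkeletonFrmFrom G) (t : V) (p : unitInterval) (D : Skelφ.StepI.DataNS V) (mk : ℕ) (g : ℕ) (f : ℕ) (qq : ℕ) {W : ℕ} (hn : 1 ≤ nL κ Φ t p D g f) (hW : (ℓB0 κ Φ t p D mk : ℤ) + 2 * KS0.R'0 κ Φ t p D mk + 1 ≤ W) (hRq : KS0.R'0 κ Φ t p D mk ≤ qq) :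
    X1 κ Φ t p D mk g f qq - qq ≤ (B0 κ Φ t p D mk g f).core1Lo 0 ∧ (B0 κ Φ t p D mk g f).core1Hi 0 ≤ X1 κ Φ t p D mk g f qq + qq ∧
    -(((nL κ Φ t p D g f * ℓL κ Φ t p D g f / shearUnit (nL κ Φ t p D g f) (hL κ Φ t p D g f) + 1 + W : ℕ) : ℤ) *
          (shearUnit (nL κ Φ t p D g f) (hL κ Φ t p D g f) : ℤ)) ≤
        (nL κ Φ t p D g f : ℤ) * ((B0 κ Φ t p D mk g f).core1Lo 1 - Y1 κ Φ t p D mk g f qq) -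
          hL κ Φ t p D g f * ((B0 κ Φ t p D mk g f).core1Lo 0 - X1 κ Φ t p D mk g f qq) ∧
    -(((nL κ Φ t p D g f * ℓL κ Φ t p D g f / shearUnit (nL κ Φ t p D g f) (hL κ Φ t p D g f) + 1 + W : ℕ) : ℤ) *
          (shearUnit (nL κ Φ t p D g f) (hL κ Φ t p D g f) : ℤ)) ≤
        (nL κ Φ t p D g f : ℤ) * ((B0 κ Φ t p D mk g f).core1Lo 1 - Y1 κ Φ t p D mk g f qq) -
          hL κ Φ t p D g f * ((B0 κ Φ t p D mk g f).core1Hi 0 - X1 κ Φ t p D mk g f qq) ∧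
    (nL κ Φ t p D g f : ℤ) * ((B0 κ Φ t p D mk g f).core1Hi 1 - Y1 κ Φ t p D mk g f qq) -
          hL κ Φ t p D g f * ((B0 κ Φ t p D mk g f).core1Lo 0 - X1 κ Φ t p D mk g f qq) ≤
        ((nL κ Φ t p D g f * ℓL κ Φ t p D g f / shearUnit (nL κ Φ t p D g f) (hL κ Φ t p D g f) + 1 + W : ℕ) : ℤ) *
          (shearUnit (nL κ Φ t p D g f) (hL κ Φ t p D g f) : ℤ) ∧
    (nL κ Φ t p D g f : ℤ) * ((B0 κ Φ t p D mk g f).core1Hi 1 - Y1 κ Φ t p D mk g f qq) -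
          hL κ Φ t p D g f * ((B0 κ Φ t p D mk g f).core1Hi 0 - X1 κ Φ t p D mk g f qq) ≤
        ((nL κ Φ t p D g f * ℓL κ Φ t p D g f / shearUnit (nL κ Φ t p D g f) (hL κ Φ t p D g f) + 1 + W : ℕ) : ℤ) *
          (shearUnit (nL κ Φ t p D g f) (hL κ Φ t p D g f) : ℤ) := by
  obtain ⟨c0, c1, c2, c3⟩ := B0_core1 κ Φ t p D mk g f
  have hn0 : (0 : ℤ) < (nL κ Φ t p D g f : ℤ) := by exact_mod_cast hn
  have hR0 : (0 : ℤ) ≤ (KS0.R'0 κ Φ t p D mk : ℤ) := by positivity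
  have hRq' : ((KS0.R'0 κ Φ t p D mk : ℕ) : ℤ) ≤ (qq : ℤ) := by exact_mod_cast hRq
  have hW0 : (0 : ℤ) ≤ (W : ℤ) := by positivity
  have hℓ0 : (0 : ℤ) ≤ (ℓL κ Φ t p D g f : ℤ) := by positivity
  -- the shear unit and the budget `B := (P + W)·U ≥ n_Lℓ_L + 1 + W·n_L + W·|h_L|`
  have hU : (shearUnit (nL κ Φ t p D g f) (hL κ Φ t p D g f) : ℤ) = (nL κ Φ t p D g f : ℤ) + |hL κ Φ t p D g f| := by
    unfold Skelφ.shearUnit; push_cast [Int.natCast_natAbs]; rfl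
  have hB := budget_mul_shearUnit_ge (nL κ Φ t p D g f) (ℓL κ Φ t p D g f) W (hL κ Φ t p D g f) hn
  rw [hU] at hB ⊢
  have hBd : ((nL κ Φ t p D g f : ℤ)) * (ℓL κ Φ t p D g f : ℤ) + 1 + (W : ℤ) * (nL κ Φ t p D g f : ℤ) + (W : ℤ) * |hL κ Φ t p D g f| ≤
      (((nL κ Φ t p D g f * ℓL κ Φ t p D g f / shearUnit (nL κ Φ t p D g f) (hL κ Φ t p D g f) + 1 + W : ℕ) : ℤ)) *
        ((nL κ Φ t p D g f : ℤ) + |hL κ Φ t p D g f|) := by linarith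
  -- the placement residue `E = h q − n ⌊h q / n⌋ ∈ [0, n)`
  have hE0 : 0 ≤ hL κ Φ t p D g f * (qq : ℤ) - (nL κ Φ t p D g f : ℤ) * (hL κ Φ t p D g f * (qq : ℤ) / (nL κ Φ t p D g f : ℤ)) := by
    have := Int.emod_nonneg (hL κ Φ t p D g f * (qq : ℤ)) (ne_of_gt hn0); rw [Int.emod_def] at this; linarith
  have hEn : hL κ Φ t p D g f * (qq : ℤ) - (nL κ Φ t p D g f : ℤ) * (hL κ Φ t p D g f * (qq : ℤ) / (nL κ Φ t p D g f : ℤ)) < (nL κ Φ t p D g f : ℤ) := by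
    have := Int.emod_lt_of_pos (hL κ Φ t p D g f * (qq : ℤ)) hn0; rw [Int.emod_def] at this; linarith
  -- the products
  have hha : |hL κ Φ t p D g f * (KS0.R'0 κ Φ t p D mk : ℤ)| = |hL κ Φ t p D g f| * (KS0.R'0 κ Φ t p D mk : ℤ) := by rw [abs_mul, abs_of_nonneg hR0]
  obtain ⟨hhR1, hhR2⟩ := abs_le.1 (le_of_eq hha)
  have hWn : ((ℓB0 κ Φ t p D mk : ℤ) + 2 * KS0.R'0 κ Φ t p D mk + 1) * (nL κ Φ t p D g f : ℤ) ≤ (W : ℤ) * (nL κ Φ t p D g f : ℤ) :=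
    mul_le_mul_of_nonneg_right hW hn0.le
  have hWh : 2 * (KS0.R'0 κ Φ t p D mk : ℤ) * |hL κ Φ t p D g f| ≤ (W : ℤ) * |hL κ Φ t p D g f| :=
    mul_le_mul_of_nonneg_right (by linarith) (abs_nonneg _)
  have hnℓb : (0 : ℤ) ≤ (nL κ Φ t p D g f : ℤ) * (ℓB0 κ Φ t p D mk : ℤ) := by positivity
  have hnR : (0 : ℤ) ≤ (nL κ Φ t p D g f : ℤ) * (KS0.R'0 κ Φ t p D mk : ℤ) := by positivity
  have habs : (0 : ℤ) ≤ |hL κ Φ t p D g f| := abs_nonneg _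
  have hnℓ : (0 : ℤ) ≤ (nL κ Φ t p D g f : ℤ) * (ℓL κ Φ t p D g f : ℤ) := by positivity
  have hWn0 : (0 : ℤ) ≤ (W : ℤ) * (nL κ Φ t p D g f : ℤ) := by positivity
  have hWh0 : (0 : ℤ) ≤ (W : ℤ) * |hL κ Φ t p D g f| := by positivity
  -- closed forms everywhere
  rw [X1_eq, Y1_eq, c0, c1, c2, c3]
  refine ⟨by linarith, by linarith, by linarith, by linarith, by linarith, by linarith⟩

/-! ## §3 The cross link -/

/-- **`hx` FOR THE ROOT LEG**: at a landing vertex `c₁` over `(X1, Y1)` (any map `ψ`), every root-frame point of the root bridge's core-`1` box lies in core `0` of the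
corridor `kgCorrSched (HK.kgVals_ok₁ N) (HK.kgVals_ok₂ N) (HK.kgVals_split N)` read through `runX ψ c₁ n_L h_L 1` — for EVERY row set `HK` at `R′ := R'0` with
`ℓB0 + 2R'0 + 1 ≤ W` and `R'0 ≤ q`. [cite: KozmaNitzan2024, §4 Lemma 11 (p. 22)] -/
theorem hx_0 (κ : Consts) {V : Type} [DecidableEq V] [Countable V] {G : SimpleGraph V} [G.LocallyFinite] (Φ : PlanarSkeletonFrmFrom G) (t : V) (p : unitInterval) (D : Skelφ.StepI.DataNS V) (mk : ℕ) (g : ℕ) (f : ℕ) (qq : ℕ) {ρ W : ℕ} (HK : Skelφ.KGRows (nL κ Φ t p D g f) (ℓL κ Φ t p D g f) (hL κ Φ t p D g f) (vL κ Φ t p D g f) (KS0.R'0 κ Φ t p D mk) ρ qq W) (N : ℕ)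
    (hW : (ℓB0 κ Φ t p D mk : ℤ) + 2 * KS0.R'0 κ Φ t p D mk + 1 ≤ W) (hRq : KS0.R'0 κ Φ t p D mk ≤ qq)
    {ψ : V → Site 2} {c₁ : V} (hX : ψ c₁ 0 - ψ t 0 = X1 κ Φ t p D mk g f qq) (hY : ψ c₁ 1 - ψ t 1 = Y1 κ Φ t p D mk g f qq)
    {w : V} (hw : rootFrame ψ t 1 w ∈ Finset.Icc (B0 κ Φ t p D mk g f).core1Lo (B0 κ Φ t p D mk g f).core1Hi) :
    Skelφ.runX ψ c₁ (nL κ Φ t p D g f) (hL κ Φ t p D g f) 1 w ∈ (Skelφ.kgCorrSched (HK.kgVals_ok₁ N) (HK.kgVals_ok₂ N) (HK.kgVals_split N)).core 0 := by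
  obtain ⟨hx0, hx1, hs₁, hs₂, hs₃, hs₄⟩ := hx_rows_0 κ Φ t p D mk g f qq HK.hn hW hRq
  exact Skelφ.runX_mem_kgCorrSched_core_zero_of_rootFrame (HK.kgVals_ok₁ N) (HK.kgVals_ok₂ N) (HK.kgVals_split N) HK.hn t c₁ hX hY hx0 hx1 hs₁ hs₂ hs₃ hs₄ hw

end Landing

end KS

end NegB

end PlanarSkeletonFrmFrom

end Summit.CriticalPhenomena.PercolationContinuityZ3.Theorems.Transplant

end
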